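import Summits.CriticalPhenomena.PercolationContinuityZ3.Theorems.PercNearOneGluingNoHeavyQuantThetaGermAtOne
import Summits.CriticalPhenomena.PercolationContinuityZ3.Theorems.PercNearOneGluingNoHeavyQuantClusterMomentsSmoothAtOne
import HarnessLib

/-!
# The Taylor germs of `χ^f` and `κ` at `p = 1`: flat to order `2d − 1`, `2d`-th left derivative `(2d)!`,
# every `d ≥ 2` (quant lane, METHOD = differential inequalities for `θ`, seat p4 gen 15)

builds on p205010 (kernel theorem, internal audit signed; external expert review pending) — NOT used in this file.

Companion of `…QuantThetaGermAtOne` (`θ`): for the weighted cluster-moment series `Σ_n w n H_n` of the closed-window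
engine (`…QuantThetaSmoothAtOne`), `Σ_n w n H_n^{(k)}(1) = 0` for `k < 2d` and `= w 1 · (2d)!` for `k = 2d`
(`…QuantThetaGermAtOne` §2: `H_n^{(k)}(1) = 0`, `H_n^{(2d)}(1) = (2d)!·𝟙{n=1}`).  Hence, within `(-∞, 1]` at `1`:

* `χ^f` (weights `n`): **`ChiF.iteratedDerivWithin_Iic_chiF_one_eq_zero`** (`(χ^f)^{(m)}(1⁻) = 0`, `m < 2d`, including
  `χ^f(1) = 0`), **`ChiF.iteratedDerivWithin_Iic_chiF_one_two_mul`** (`(χ^f)^{(2d)}(1⁻) = (2d)!`),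
  **`ChiF.hasDerivWithinAt_chiF_one`** (`(χ^f)'(1⁻) = 0`);
* `κ` (weights `n⁻¹`): **`Kappa.iteratedDerivWithin_Iic_kappa_one_eq_zero`**, **`Kappa.iteratedDerivWithin_Iic_kappa_one_two_mul`**
  (`κ^{(2d)}(1⁻) = (2d)!`), **`Kappa.hasDerivWithinAt_kappa_one`**.

I.e. `χ^f(p) = (1−p)^{2d} + O((1−p)^{2d+1})`, `κ(p) = (1−p)^{2d} + O((1−p)^{2d+1})` at the level of left Taylor
coefficients (the isolated-origin term).  HONEST STATUS: elementary consequence (ours) of the reproduced Thm. (8.92)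
at `p = 1`; no rate, nothing at `p_c`.

## References
* G. Grimmett, *Percolation*, 2nd ed. (1999): §8.7 Thm. (8.92) and the remark after it; (1.30), (4.18)
  [GrimmettPercolation1999].
-/

noncomputable section

namespace Summit.CriticalPhenomena.PercolationContinuityZ3.Theorems

open MeasureTheory Set Filter Topology Literature.Probability.Percolation Literature.Probability.LatticeModels
open scoped Classical

variable {d : ℕ}

namespace ThetaGerm

/-! ### §1. Weighted series at `p = 1` -/

/-- Iterated derivatives within the window of the weighted series:
`(Σ_n w n H_n^{(k)})^{(m)} = Σ_n w n H_n^{(k+m)}` on `[a, 1]`. -/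
theorem iteratedDerivWithin_tsum_window_weight (hd : 2 ≤ d) {w : ℕ → ℝ} {j : ℕ} (hw : ∀ n, |w n| ≤ ((n : ℝ) + 1) ^ j) {a : ℝ} (ha : (1 - ((1 / (2 * (2 * (3 ^ d + 1 : ℝ) ^ 2))) ^ (5 ^ d) / ((edgesIn (zdGraph d) (box d 2)).card : ℝ))) < a)
    (ha1 : a < 1) (m : ℕ) : ∀ k : ℕ, ∀ y ∈ Set.Icc a 1,
    iteratedDerivWithin m (fun z : ℝ => (∑' n : ℕ, w n * iteratedDeriv k (Russo.cylPoly (zdGraph d).edgeSet (edgesTouching (zdGraph d) (box d n)) {ω : BondConfig (Site d) | ω ∩ (zdGraph d).edgeSet ∈ {ω' : BondConfig (Site d) | (openCluster ω' 0).Finite ∧ (openCluster ω' 0).ncard = n}}) z)) (Set.Icc a 1) y = (∑' n : ℕ, w n * iteratedDeriv (k + m) (Russo.cylPoly (zdGraph d).edgeSet (edgesTouching (zdGraph d) (box d n)) {ω : BondConfig (Site d) | ω ∩ (zdGraph d).edgeSet ∈ {ω' : BondConfig (Site d) | (openCluster ω' 0).Finite ∧ (openCluster ω' 0).ncard = n}})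 y) := by
  induction m with
  | zero => intro k y _; rw [iteratedDerivWithin_zero, add_zero]
  | succ m ih =>
    intro k y hy
    rw [iteratedDerivWithin_succ']
    have heq : Set.EqOn (derivWithin (fun z : ℝ => (∑' n : ℕ, w n * iteratedDeriv k (Russo.cylPoly (zdGraph d).edgeSet (edgesTouching (zdGraph d) (box d n)) {ω : BondConfig (Site d) | ω ∩ (zdGraph d).edgeSet ∈ {ω' : BondConfig (Site d) | (openCluster ω' 0).Finite ∧ (openCluster ω' 0).ncard = n}}) z)) (Set.Icc a 1)) (fun z : ℝ => (∑' n : ℕ, w n * iteratedDeriv (k + 1) (Russo.cylPoly (zdGraph d).edgeSet (edgesTouching (zdGraph d) (box d n)) {ω : BondConfig (Site d) | ω ∩ (zdGraph d).edgeSet ∈ {ω' : BondConfig (Site d) | (openCluster ω' 0).Finite ∧ (openCluster ω' 0).ncard = n}}) z))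
        (Set.Icc a 1) :=
      fun z hz => (ChiF.hasDerivWithinAt_tsum_window hd hw ha ha1 k hz).derivWithin (uniqueDiffOn_Icc ha1 z hz)
    rw [iteratedDerivWithin_congr heq hy, ih (k + 1) y hy, show k + (m + 1) = k + 1 + m by omega]

/-- `Σ_n w n H_n^{(k)}(1) = 0` for `k < 2d`. -/
theorem tsum_weight_iteratedDeriv_one_eq_zero (hd : 2 ≤ d) (w : ℕ → ℝ) {k : ℕ} (hk : k < 2 * d) :
    (∑' n : ℕ, w n * iteratedDeriv k (Russo.cylPoly (zdGraph d).edgeSet (edgesTouching (zdGraph d) (box d n)) {ω : BondConfig (Site d) | ω ∩ (zdGraph d).edgeSet ∈ {ω' : BondConfig (Site d) | (openCluster ω' 0).Finite ∧ (openCluster ω' 0).ncard = n}}) 1) = 0 := by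
  have h : ∀ n : ℕ, iteratedDeriv k (Russo.cylPoly (zdGraph d).edgeSet (edgesTouching (zdGraph d) (box d n)) {ω : BondConfig (Site d) | ω ∩ (zdGraph d).edgeSet ∈ {ω' : BondConfig (Site d) | (openCluster ω' 0).Finite ∧ (openCluster ω' 0).ncard = n}}) 1 = 0 := fun n => iteratedDeriv_cylPoly_one_eq_zero hd n hk
  simp only [h, mul_zero, tsum_zero]

/-- `Σ_n w n H_n^{(2d)}(1) = w 1 · (2d)!`. -/
theorem tsum_weight_iteratedDeriv_one_two_mul (hd : 2 ≤ d) (w : ℕ → ℝ) :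
    (∑' n : ℕ, w n * iteratedDeriv (2 * d) (Russo.cylPoly (zdGraph d).edgeSet (edgesTouching (zdGraph d) (box d n)) {ω : BondConfig (Site d) | ω ∩ (zdGraph d).edgeSet ∈ {ω' : BondConfig (Site d) | (openCluster ω' 0).Finite ∧ (openCluster ω' 0).ncard = n}}) 1) = w 1 * ((2 * d).factorial : ℝ) := by
  simp only [iteratedDeriv_cylPoly_one_two_mul hd, mul_ite, mul_zero]
  rw [tsum_ite_eq]

/-- A point of the window above `p_c`. -/
theorem exists_window_gt (hd : 2 ≤ d) : ∃ a : ℝ, (1 - ((1 / (2 * (2 * (3 ^ d + 1 : ℝ) ^ 2))) ^ (5 ^ d) / ((edgesIn (zdGraph d) (box d 2)).card : ℝ))) < a ∧ (criticalProbI d : ℝ) < a ∧ a < 1 := by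
  have h0 := ChiF.windowConst_mem_Ico (d := d) (by omega)
  have hpc1 : (criticalProbI d : ℝ) < 1 := by rw [coe_criticalProbI]; exact criticalProb_zd_lt_one hd
  refine ⟨(max (1 - ((1 / (2 * (2 * (3 ^ d + 1 : ℝ) ^ 2))) ^ (5 ^ d) / ((edgesIn (zdGraph d) (box d 2)).card : ℝ))) (criticalProbI d : ℝ) + 1) / 2, ?_, ?_, ?_⟩
  · linarith [le_max_left (1 - ((1 / (2 * (2 * (3 ^ d + 1 : ℝ) ^ 2))) ^ (5 ^ d) / ((edgesIn (zdGraph d) (box d 2)).card : ℝ))) (criticalProbI d : ℝ), max_lt h0.2 hpc1]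
  · linarith [le_max_right (1 - ((1 / (2 * (2 * (3 ^ d + 1 : ℝ) ^ 2))) ^ (5 ^ d) / ((edgesIn (zdGraph d) (box d 2)).card : ℝ))) (criticalProbI d : ℝ), max_lt h0.2 hpc1]
  · linarith [max_lt h0.2 hpc1]

end ThetaGerm

namespace ChiF

/-! ### §2. `χ^f` at `p = 1` -/

/-- **`(χ^f)^{(m)}(1⁻) = 0` for `m < 2d`** within a window `[a,1]`, `a ∈ (a₀,1)`, `a > p_c` (includes `χ^f(1) = 0`). -/
theorem iteratedDerivWithin_chiF_one_eq_zero (hd : 2 ≤ d) {a : ℝ} (ha : (1 - ((1 / (2 * (2 * (3 ^ d + 1 : ℝ) ^ 2))) ^ (5 ^ d) / ((edgesIn (zdGraph d) (box d 2)).card : ℝ))) < a)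
    (hac : (criticalProbI d : ℝ) < a) (ha1 : a < 1) {m : ℕ} (hm : m < 2 * d) :
    iteratedDerivWithin m (fun r : ℝ => (meanClusterSize (zdGraph d) (0 : Site d) (GhostField.prm r)).toReal) (Set.Icc a 1) 1 = 0 := by
  have hw : ∀ n : ℕ, |(fun n : ℕ => (n : ℝ)) n| ≤ ((n : ℝ) + 1) ^ 1 := fun n => by
    rw [abs_of_nonneg (Nat.cast_nonneg n), pow_one]; linarith
  have h1 : (1 : ℝ) ∈ Set.Icc a 1 := Set.right_mem_Icc.2 ha1.le
  have heq : Set.EqOn (fun r : ℝ => (meanClusterSize (zdGraph d) (0 : Site d) (GhostField.prm r)).toReal) (fun y : ℝ => ∑' n : ℕ, (fun n : ℕ => (n : ℝ)) n * iteratedDeriv 0 (Russo.cylPoly (zdGraph d).edgeSet (edgesTouching (zdGraph d) (box d n)) {ω : BondConfig (Site d) | ω ∩ (zdGraph d).edgeSet ∈ {ω' : BondConfig (Site d) | (openCluster ω' 0).Finite ∧ (openCluster ω' 0).ncard = n}}) y) (Set.Icc a 1) :=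
    fun y hy => meanClusterSize_prm_toReal_eq_tsum_cylPoly hd (hac.trans_le hy.1) hy.2
  rw [iteratedDerivWithin_congr heq h1, ThetaGerm.iteratedDerivWithin_tsum_window_weight hd hw ha ha1 m 0 1 h1, zero_add]
  exact ThetaGerm.tsum_weight_iteratedDeriv_one_eq_zero hd _ hm

/-- **`(χ^f)^{(2d)}(1⁻) = (2d)!`** within a window `[a,1]`, `a > p_c`. -/
theorem iteratedDerivWithin_chiF_one_two_mul (hd : 2 ≤ d) {a : ℝ} (ha : (1 - ((1 / (2 * (2 * (3 ^ d + 1 : ℝ) ^ 2))) ^ (5 ^ d) / ((edgesIn (zdGraph d) (box d 2)).card : ℝ))) < a)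
    (hac : (criticalProbI d : ℝ) < a) (ha1 : a < 1) :
    iteratedDerivWithin (2 * d) (fun r : ℝ => (meanClusterSize (zdGraph d) (0 : Site d) (GhostField.prm r)).toReal) (Set.Icc a 1) 1 = ((2 * d).factorial : ℝ) := by
  have hw : ∀ n : ℕ, |(fun n : ℕ => (n : ℝ)) n| ≤ ((n : ℝ) + 1) ^ 1 := fun n => by
    rw [abs_of_nonneg (Nat.cast_nonneg n), pow_one]; linarith
  have h1 : (1 : ℝ) ∈ Set.Icc a 1 := Set.right_mem_Icc.2 ha1.le
  have heq : Set.EqOn (fun r : ℝ => (meanClusterSize (zdGraph d) (0 : Site d) (GhostField.prm r)).toReal) (fun y : ℝ => ∑' n : ℕ, (fun n : ℕ => (n : ℝ)) n * iteratedDeriv 0 (Russo.cylPoly (zdGraph d).edgeSet (edgesTouching (zdGraph d) (box d n)) {ω : BondConfig (Site d) | ω ∩ (zdGraph d).edgeSet ∈ {ω' : BondConfig (Site d) | (openCluster ω' 0).Finite ∧ (openCluster ω' 0).ncard = n}}) y) (Set.Icc a 1) :=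
    fun y hy => meanClusterSize_prm_toReal_eq_tsum_cylPoly hd (hac.trans_le hy.1) hy.2
  rw [iteratedDerivWithin_congr heq h1, ThetaGerm.iteratedDerivWithin_tsum_window_weight hd hw ha ha1 (2 * d) 0 1 h1, zero_add,
    ThetaGerm.tsum_weight_iteratedDeriv_one_two_mul hd]
  simp

/-- **Window-free: `(χ^f)^{(m)}(1⁻) = 0`, `m < 2d`**, within `(-∞, 1]`. -/
theorem iteratedDerivWithin_Iic_chiF_one_eq_zero (hd : 2 ≤ d) {m : ℕ} (hm : m < 2 * d) :
    iteratedDerivWithin m (fun r : ℝ => (meanClusterSize (zdGraph d) (0 : Site d) (GhostField.prm r)).toReal) (Set.Iic 1) 1 = 0 := by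
  obtain ⟨a, ha, hac, ha1⟩ := ThetaGerm.exists_window_gt hd
  rw [iteratedDerivWithin_eq_iteratedFDerivWithin, ← iteratedFDerivWithin_congr_set (ThetaGerm.Icc_eventuallyEq_Iic ha1),
    ← iteratedDerivWithin_eq_iteratedFDerivWithin]
  exact iteratedDerivWithin_chiF_one_eq_zero hd ha hac ha1 hm

/-- **Window-free: `(χ^f)^{(2d)}(1⁻) = (2d)!`**, within `(-∞, 1]`. -/
theorem iteratedDerivWithin_Iic_chiF_one_two_mul (hd : 2 ≤ d) :
    iteratedDerivWithin (2 * d) (fun r : ℝ => (meanClusterSize (zdGraph d) (0 : Site d) (GhostField.prm r)).toReal) (Set.Iic 1) 1 = ((2 * d).factorial : ℝ) := by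
  obtain ⟨a, ha, hac, ha1⟩ := ThetaGerm.exists_window_gt hd
  rw [iteratedDerivWithin_eq_iteratedFDerivWithin, ← iteratedFDerivWithin_congr_set (ThetaGerm.Icc_eventuallyEq_Iic ha1),
    ← iteratedDerivWithin_eq_iteratedFDerivWithin]
  exact iteratedDerivWithin_chiF_one_two_mul hd ha hac ha1

/-- **`(χ^f)'(1⁻) = 0`**: left derivative `0` at `p = 1`. -/
theorem hasDerivWithinAt_chiF_one (hd : 2 ≤ d) : HasDerivWithinAt (fun r : ℝ => (meanClusterSize (zdGraph d) (0 : Site d) (GhostField.prm r)).toReal) 0 (Set.Iic 1) 1 := by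
  obtain ⟨a, ha, hac, ha1⟩ := ThetaGerm.exists_window_gt hd
  have hw : ∀ n : ℕ, |(fun n : ℕ => (n : ℝ)) n| ≤ ((n : ℝ) + 1) ^ 1 := fun n => by
    rw [abs_of_nonneg (Nat.cast_nonneg n), pow_one]; linarith
  have h1 : (1 : ℝ) ∈ Set.Icc a 1 := Set.right_mem_Icc.2 ha1.le
  have hS := hasDerivWithinAt_tsum_window hd hw ha ha1 0 h1
  rw [zero_add, ThetaGerm.tsum_weight_iteratedDeriv_one_eq_zero hd _ (show 1 < 2 * d by omega)] at hS
  refine (hS.congr_of_mem (fun y hy => ?_) h1).mono_of_mem_nhdsWithin (Icc_mem_nhdsLE ha1)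
  exact meanClusterSize_prm_toReal_eq_tsum_cylPoly hd (hac.trans_le hy.1) hy.2

end ChiF

namespace Kappa

/-! ### §3. `κ` at `p = 1` -/

/-- **`κ^{(m)}(1⁻) = 0` for `m < 2d`** within a window `[a,1]`, `a ∈ (a₀,1)` (includes `κ(1) = 0`). -/
theorem iteratedDerivWithin_kappa_one_eq_zero (hd : 2 ≤ d) {a : ℝ} (ha : (1 - ((1 / (2 * (2 * (3 ^ d + 1 : ℝ) ^ 2))) ^ (5 ^ d) / ((edgesIn (zdGraph d) (box d 2)).card : ℝ))) < a) (ha1 : a < 1) {m : ℕ}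
    (hm : m < 2 * d) : iteratedDerivWithin m (fun r : ℝ => kappa (zdGraph d) 0 (GhostField.prm r)) (Set.Icc a 1) 1 = 0 := by
  have ha0 : 0 ≤ a := (ChiF.windowConst_mem_Ico (d := d) (by omega)).1.trans ha.le
  have h1 : (1 : ℝ) ∈ Set.Icc a 1 := Set.right_mem_Icc.2 ha1.le
  have heq : Set.EqOn (fun r : ℝ => kappa (zdGraph d) 0 (GhostField.prm r)) (fun y : ℝ => ∑' n : ℕ, (fun n : ℕ => ((n : ℝ))⁻¹) n * iteratedDeriv 0 (Russo.cylPoly (zdGraph d).edgeSet (edgesTouching (zdGraph d) (box d n)) {ω : BondConfig (Site d) | ω ∩ (zdGraph d).edgeSet ∈ {ω' : BondConfig (Site d) | (openCluster ω' 0).Finite ∧ (openCluster ω' 0).ncard = n}}) y) (Set.Icc a 1) :=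
    fun y hy => kappa_prm_eq_tsum_cylPoly ⟨ha0.trans hy.1, hy.2⟩
  rw [iteratedDerivWithin_congr heq h1,
    ThetaGerm.iteratedDerivWithin_tsum_window_weight hd abs_inv_natCast_le ha ha1 m 0 1 h1, zero_add]
  exact ThetaGerm.tsum_weight_iteratedDeriv_one_eq_zero hd _ hm

/-- **`κ^{(2d)}(1⁻) = (2d)!`** within a window `[a,1]`. -/
theorem iteratedDerivWithin_kappa_one_two_mul (hd : 2 ≤ d) {a : ℝ} (ha : (1 - ((1 / (2 * (2 * (3 ^ d + 1 : ℝ) ^ 2))) ^ (5 ^ d) / ((edgesIn (zdGraph d) (box d 2)).card : ℝ))) < a) (ha1 : a < 1) :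
    iteratedDerivWithin (2 * d) (fun r : ℝ => kappa (zdGraph d) 0 (GhostField.prm r)) (Set.Icc a 1) 1 = ((2 * d).factorial : ℝ) := by
  have ha0 : 0 ≤ a := (ChiF.windowConst_mem_Ico (d := d) (by omega)).1.trans ha.le
  have h1 : (1 : ℝ) ∈ Set.Icc a 1 := Set.right_mem_Icc.2 ha1.le
  have heq : Set.EqOn (fun r : ℝ => kappa (zdGraph d) 0 (GhostField.prm r)) (fun y : ℝ => ∑' n : ℕ, (fun n : ℕ => ((n : ℝ))⁻¹) n * iteratedDeriv 0 (Russo.cylPoly (zdGraph d).edgeSet (edgesTouching (zdGraph d) (box d n)) {ω : BondConfig (Site d) | ω ∩ (zdGraph d).edgeSet ∈ {ω' : BondConfig (Site d) | (openCluster ω' 0).Finite ∧ (openCluster ω' 0).ncard = n}}) y) (Set.Icc a 1) :=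
    fun y hy => kappa_prm_eq_tsum_cylPoly ⟨ha0.trans hy.1, hy.2⟩
  rw [iteratedDerivWithin_congr heq h1,
    ThetaGerm.iteratedDerivWithin_tsum_window_weight hd abs_inv_natCast_le ha ha1 (2 * d) 0 1 h1, zero_add,
    ThetaGerm.tsum_weight_iteratedDeriv_one_two_mul hd]
  simp

/-- **Window-free: `κ^{(m)}(1⁻) = 0`, `m < 2d`**, within `(-∞, 1]`. -/
theorem iteratedDerivWithin_Iic_kappa_one_eq_zero (hd : 2 ≤ d) {m : ℕ} (hm : m < 2 * d) :
    iteratedDerivWithin m (fun r : ℝ => kappa (zdGraph d) 0 (GhostField.prm r)) (Set.Iic 1) 1 = 0 := by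
  obtain ⟨a, ha, ha1⟩ := ThetaGerm.exists_window (d := d) (by omega)
  rw [iteratedDerivWithin_eq_iteratedFDerivWithin, ← iteratedFDerivWithin_congr_set (ThetaGerm.Icc_eventuallyEq_Iic ha1),
    ← iteratedDerivWithin_eq_iteratedFDerivWithin]
  exact iteratedDerivWithin_kappa_one_eq_zero hd ha ha1 hm

/-- **Window-free: `κ^{(2d)}(1⁻) = (2d)!`**, within `(-∞, 1]`. -/
theorem iteratedDerivWithin_Iic_kappa_one_two_mul (hd : 2 ≤ d) :
    iteratedDerivWithin (2 * d) (fun r : ℝ => kappa (zdGraph d) 0 (GhostField.prm r)) (Set.Iic 1) 1 = ((2 * d).factorial : ℝ) := by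
  obtain ⟨a, ha, ha1⟩ := ThetaGerm.exists_window (d := d) (by omega)
  rw [iteratedDerivWithin_eq_iteratedFDerivWithin, ← iteratedFDerivWithin_congr_set (ThetaGerm.Icc_eventuallyEq_Iic ha1),
    ← iteratedDerivWithin_eq_iteratedFDerivWithin]
  exact iteratedDerivWithin_kappa_one_two_mul hd ha ha1

/-- **`κ'(1⁻) = 0`**: left derivative `0` at `p = 1`. -/
theorem hasDerivWithinAt_kappa_one (hd : 2 ≤ d) : HasDerivWithinAt (fun r : ℝ => kappa (zdGraph d) 0 (GhostField.prm r)) 0 (Set.Iic 1) 1 := by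
  obtain ⟨a, ha, ha1⟩ := ThetaGerm.exists_window (d := d) (by omega)
  have ha0 : 0 ≤ a := (ChiF.windowConst_mem_Ico (d := d) (by omega)).1.trans ha.le
  have h1 : (1 : ℝ) ∈ Set.Icc a 1 := Set.right_mem_Icc.2 ha1.le
  have hS := ChiF.hasDerivWithinAt_tsum_window hd abs_inv_natCast_le ha ha1 0 h1
  rw [zero_add, ThetaGerm.tsum_weight_iteratedDeriv_one_eq_zero hd _ (show 1 < 2 * d by omega)] at hS
  refine (hS.congr_of_mem (fun y hy => ?_) h1).mono_of_mem_nhdsWithin (Icc_mem_nhdsLE ha1)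
  exact kappa_prm_eq_tsum_cylPoly ⟨ha0.trans hy.1, hy.2⟩

end Kappa

end Summit.CriticalPhenomena.PercolationContinuityZ3.Theorems

end
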